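import Summits.CriticalPhenomena.CardyFormulaZ2.Theorems.CardySelfDualSegmentUniformBoxCrossingDefs
import Summits.CriticalPhenomena.CardyFormulaZ2.Theorems.CardySelfDualSegmentUniformBoxCrossingNonSlantOfComparable
import Literature.Probability.Percolation.LowestCrossingInterface
import Literature.Probability.LatticeModels.ProdBernoulliSplice
import Literature.Probability.LatticeModels.ProdBernoulliRecolour
import HarnessLib

/-!
# Vocabulary of line `Sketch` for the crux `UniformBoxCrossing` (stmt-CriticalPhenomena-5476), part 2:
# examined coins, the resampling map `f_ALG`, the link and its junction corners; the stub statements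

Continuation of `…UniformBoxCrossingDefs.lean` (definitions-only support file of the lead's
skeleton `Cruxes/UniformBoxCrossing/Lines/Sketch.lean`). Bollobás–Riordan 2010
(arXiv:1001.4674), §5.1 proof of Thm. 5.3 and §5.2, for the corner models
`M_t = cornerPercolation t` (coins indexed by `Site 2 × Fin 2`, `CornerPercolation.lean`):

* Corner bookkeeping: `cornerOf e` (part 1) is the vertex whose coins decide the lattice edge `e`;
  `zone D` (corners owning an edge that bounds a face of `D`), `examinedCoins n s` (all coins of
  the corners in the zones of the two explorations — the stopping set `𝒮` of `f_ALG`),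
  `coinShift`, `brSplice` (the literal `f_ALG` for the corner coins, an instance of `splice` of
  `ProdBernoulliSplice.lean`).
* The link and the junction: `IsNonSlantPath` (the Non-Slant event `nonSlant m` itself is in
  `…UniformBoxCrossingNonSlantOfComparable.lean`), `nsPath` (a CHOSEN open non-slant
  top–bottom path of `[0, m]²`, a function of the configuration inside the square), `IsLink` /
  `minimalLink` (B–R's minimal sub-path from `A` to `B`, via `exists_subwalk_inter_free`),
  `endCorners` / `junctionCorners` (the corners deciding its first and last edges), `linkWalk`, and
  the recolouring data `juncCorners` / `juncSite` / `juncPattern` / `recolour` (the ≤ 4 coins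
  overwritten to open both edges at the two junction corners — Bollobás–Riordan's "adjusting the
  colourings of at most two faces", §5.2 — in the shape consumed by `mul_prod_le_of_reconstructible`
  of `ProdBernoulliRecolour.lean`).
* §Statements: the stub STATEMENTS of the reshaped engine as named `Prop`s (`NonSlantStatement`,
  `BridgeStatement`, `ExaminedStatement`, `CoverStatement`, `SmallGapStatement`,
  `JunctionStatement`, `LinkStatement`, `TBStatement`). Every `def … : Prop` here is a statement
  the LINE POSITS (a sub-goal of the crux, to be proved by a registered stub file), not a
  literature fact, never to be relocated.

Junk values: `nsPath`, `minimalLink` return a trivial walk / the walk itself when no witness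
exists (all uses supply the witness).

## References

* B. Bollobás, O. Riordan, *Percolation on self-dual polygon configurations*, Bolyai Soc. Math.
  Stud. 21 (2010) 131–217, arXiv:1001.4674, §5.1 (proof of Thm. 5.3), §5.2 (recolouring).
  [BollobasRiordan2010]
-/

noncomputable section

namespace Summit.CriticalPhenomena.CardyFormulaZ2.Cruxes.UniformBoxCrossing.NonSlantLine

open SimpleGraph Finset Literature.Probability.Percolation Literature.Probability.LatticeModels

/-! ### Corner bookkeeping: which coins of `cornerPercolation` an exploration examines -/

section Corners

variable (n s : ℕ)

/-- The **zone** of a set of faces `D`: the corners owning a lattice edge that bounds a face of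
`D` (`belowEdges D`); in the corner model the states of these edges are functions of the coins of
these corners (Bollobás–Riordan's zone of influence `Z(I)`). [cite: BollobasRiordan2010, §5.2] -/
def zone (D : Finset (Site 2)) : Finset (Site 2) := (belowEdges D).image cornerOf

/-- Membership in the zone. [folklore] -/
theorem mem_zone_iff {D : Finset (Site 2)} {z : Site 2} :
    z ∈ zone D ↔ ∃ e ∈ belowEdges D, cornerOf e = z := by
  simp [zone]

/-- **The examined coins** (the stopping set `𝒮` of `f_ALG`): every coin `(z, j)` of a corner `z`
in the zone of the lower exploration of `S₁` or of the upper exploration of `S₂`, for the coin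
configuration `S`. [cite: BollobasRiordan2010, §5.1 proof of Thm. 5.3] -/
def examinedCoins (S : Set (Site 2 × Fin 2)) : Finset (Site 2 × Fin 2) :=
  (zone (dualBelow n (cornerConfig S)) ∪ zone (dualAbove n s (cornerConfig S))) ×ˢ Finset.univ

/-- Membership in the examined coins. [folklore] -/
theorem mem_examinedCoins_iff {S : Set (Site 2 × Fin 2)} {i : Site 2 × Fin 2} :
    i ∈ examinedCoins n s S ↔
      i.1 ∈ zone (dualBelow n (cornerConfig S)) ∨ i.1 ∈ zone (dualAbove n s (cornerConfig S)) := by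
  simp [examinedCoins]

/-- The examined coins only depend on the two explored face sets. [folklore] -/
theorem examinedCoins_eq_of_eq {S S' : Set (Site 2 × Fin 2)}
    (h₁ : dualBelow n (cornerConfig S) = dualBelow n (cornerConfig S'))
    (h₂ : dualAbove n s (cornerConfig S) = dualAbove n s (cornerConfig S')) :
    examinedCoins n s S = examinedCoins n s S' := by
  simp only [examinedCoins, h₁, h₂]

/-- Translation of the coins by the lattice vector `X`: `(v, j) ↦ (v + X, j)`. [folklore] -/
def coinShift (X : Site 2) : (Site 2 × Fin 2) ≃ (Site 2 × Fin 2) :=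
  Equiv.prodCongr (Equiv.addRight X) (Equiv.refl (Fin 2))

/-- `coinShift X (v, j) = (v + X, j)`. [folklore] -/
@[simp] theorem coinShift_apply (X : Site 2) (i : Site 2 × Fin 2) : coinShift X i = (i.1 + X, i.2) := rfl

/-- The corner parameters are translation invariant. [folklore] -/
theorem cornerParam_coinShift (t : unitInterval) (X : Site 2) (i : Site 2 × Fin 2) :
    cornerParam t (coinShift X i) = cornerParam t i := rfl

/-- **Bollobás–Riordan's `f_ALG` for the corner coins**: keep the coins of `ω₁ = q.1` examined by
the two explorations, read every other coin off the independent configuration `q.2.1` translated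
by `q.2.2` (an instance of `splice` with the fresh source `(S₂, X) ↦ S₂ + X`).
[cite: BollobasRiordan2010, §5.1 eq. (fA)] -/
def brSplice (q : Set (Site 2 × Fin 2) × (Set (Site 2 × Fin 2) × Site 2)) : Set (Site 2 × Fin 2) :=
  splice (examinedCoins n s) (fun q => coinShift q.2.2 '' q.2.1) q

/-- `brSplice` is the `splice` of the examined coins with the shifted fresh source. [folklore] -/
theorem brSplice_eq :
    brSplice n s = splice (examinedCoins n s)
      (fun q : Set (Site 2 × Fin 2) × (Set (Site 2 × Fin 2) × Site 2) => coinShift q.2.2 '' q.2.1) := rfl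

end Corners

/-! ### The non-slant path, the link, the junction corners -/

section Link

/-- `w` is an open non-slant top–bottom path of `[0, m]²` in `ω`: from the bottom side to the top
side, endpoint abscissae within `3m/5`, inside the square, all edges open.
[cite: BollobasRiordan2010, §5.1 Lemma 5.2] -/
structure IsNonSlantPath (m : ℕ) (ω : BondConfig (Site 2)) (w : XWalk) : Prop where
  /-- starts on the bottom side -/
  fst_mem : w.fst ∈ bottomSide m m
  /-- ends on the top side -/
  snd_mem : w.snd ∈ topSide m m
  /-- the endpoint abscissae differ by at most `3m/5` -/
  slant : 5 * |w.snd 0 - w.fst 0| ≤ 3 * (m : ℤ)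
  /-- lies in the square -/
  subset : ∀ z ∈ w.walk.support, z ∈ rectangle m m
  /-- is open -/
  isOpen : ∀ e ∈ w.walk.edges, e ∈ ω

/-- The lattice edges with both endpoints in `[0, m]²`. [folklore] -/
def squareEdgeSet (m : ℕ) : Set (Sym2 (Site 2)) := {e | ∀ z ∈ e, z ∈ rectangle m m}

/-- On lattice configurations the Non-Slant event is witnessed by a non-slant path. [folklore] -/
theorem exists_isNonSlantPath {m : ℕ} {ω : BondConfig (Site 2)} (hω : ω ⊆ (zdGraph 2).edgeSet)
    (h : ω ∈ nonSlant m) : ∃ w, IsNonSlantPath m ω w := by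
  obtain ⟨x, hx, y, hy, hsl, hconn⟩ := h
  obtain ⟨W, hWS, hWω⟩ := exists_walk_of_mem_openConnIn hω hconn
  exact ⟨⟨x, y, W⟩, hx, hy, hsl, fun z hz => Finset.mem_coe.1 (hWS z hz), hWω⟩

/-- A non-slant path of `ω` is a non-slant path of `ω` restricted to the square. [folklore] -/
theorem IsNonSlantPath.inter_squareEdgeSet {m : ℕ} {ω : BondConfig (Site 2)} {w : XWalk}
    (h : IsNonSlantPath m ω w) : IsNonSlantPath m (ω ∩ squareEdgeSet m) w := by
  refine ⟨h.fst_mem, h.snd_mem, h.slant, h.subset, fun e he => ⟨h.isOpen e he, fun z hz => ?_⟩⟩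
  exact h.subset z (Walk.mem_support_of_mem_edges (by simpa using he) hz)

/-- **The chosen non-slant path** of `ω` in `[0, m]²` (a function of `ω ∩ squareEdgeSet m`; the
trivial walk at the origin if there is none). [cite: BollobasRiordan2010, §5.1 proof of Thm. 5.3] -/
def nsPath (m : ℕ) (ω : BondConfig (Site 2)) : XWalk := by
  classical
  exact if h : ∃ w, IsNonSlantPath m (ω ∩ squareEdgeSet m) w then h.choose else XWalk.nil 0

/-- `nsPath` only depends on the configuration inside the square. [folklore] -/
theorem nsPath_congr {m : ℕ} {ω ω' : BondConfig (Site 2)}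
    (h : ω ∩ squareEdgeSet m = ω' ∩ squareEdgeSet m) : nsPath m ω = nsPath m ω' := by
  classical
  simp only [nsPath, h]

/-- The chosen path is a non-slant path whenever one exists. [folklore] -/
theorem isNonSlantPath_nsPath {m : ℕ} {ω : BondConfig (Site 2)} {w : XWalk} (hw : IsNonSlantPath m ω w) :
    IsNonSlantPath m ω (nsPath m ω) := by
  classical
  have hex : ∃ w, IsNonSlantPath m (ω ∩ squareEdgeSet m) w := ⟨w, hw.inter_squareEdgeSet⟩
  have hspec := hex.choose_spec
  simp only [nsPath, dif_pos hex]
  exact ⟨hspec.fst_mem, hspec.snd_mem, hspec.slant, hspec.subset, fun e he => (hspec.isOpen e he).1⟩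

/-- `q` is a **link of `w` from `A` to `B`**: a sub-walk of `w` (its darts among those of `w`) from
a vertex of `A` to a vertex of `B` whose steps start outside `B` and end outside `A`
(Bollobás–Riordan's minimal sub-path `P'`). [cite: BollobasRiordan2010, §5.1 proof of Thm. 5.3] -/
structure IsLink (A B : Set (Site 2)) (w q : XWalk) : Prop where
  /-- starts in `A` -/
  fst_mem : q.fst ∈ A
  /-- ends in `B` -/
  snd_mem : q.snd ∈ B
  /-- is a sub-walk of `w` -/
  darts_sub : ∀ d ∈ q.walk.darts, d ∈ w.walk.darts
  /-- steps start outside `B` -/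
  fst_notMem : ∀ d ∈ q.walk.darts, d.fst ∉ B
  /-- steps end outside `A` -/
  snd_notMem : ∀ d ∈ q.walk.darts, d.snd ∉ A

/-- A walk from `A` to `B` has a link (`exists_subwalk_inter_free`). [cite: BollobasRiordan2010, §5.1 proof of Thm. 5.3] -/
theorem exists_isLink {A B : Set (Site 2)} {w : XWalk} (hA : w.fst ∈ A) (hB : w.snd ∈ B) :
    ∃ q, IsLink A B w q := by
  obtain ⟨a', ha', b', hb', q, hsub, hfst, hsnd⟩ := exists_subwalk_inter_free w.walk hA hB
  exact ⟨⟨a', b', q⟩, ha', hb', hsub, hfst, hsnd⟩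

/-- **The chosen link** of `w` from `A` to `B` (junk: `w` itself if there is none).
[cite: BollobasRiordan2010, §5.1 proof of Thm. 5.3] -/
def minimalLink (A B : Set (Site 2)) (w : XWalk) : XWalk := by
  classical
  exact if h : ∃ q, IsLink A B w q then h.choose else w

/-- The chosen link is a link whenever `w` runs from `A` to `B`. [folklore] -/
theorem isLink_minimalLink {A B : Set (Site 2)} {w : XWalk} (hA : w.fst ∈ A) (hB : w.snd ∈ B) :
    IsLink A B w (minimalLink A B w) := by
  classical
  have hex := exists_isLink hA hB
  simp only [minimalLink, dif_pos hex]
  exact hex.choose_spec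

/-- The corners deciding the first and the last edge of a walk (empty for a trivial walk; one
corner if the walk has a single edge or both corners coincide). [folklore] -/
def endCorners (q : XWalk) : Finset (Site 2) :=
  ((q.walk.darts.head?.map fun d => cornerOf d.edge).toList ++
    (q.walk.darts.getLast?.map fun d => cornerOf d.edge).toList).toFinset

/-- `endCorners` has at most two elements. [folklore] -/
theorem card_endCorners_le (q : XWalk) : (endCorners q).card ≤ 2 := by
  unfold endCorners
  refine (List.toFinset_card_le _).trans ?_
  rw [List.length_append]
  have h1 : (q.walk.darts.head?.map fun d => cornerOf d.edge).toList.length ≤ 1 := by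
    cases q.walk.darts.head? <;> simp
  have h2 : (q.walk.darts.getLast?.map fun d => cornerOf d.edge).toList.length ≤ 1 := by
    cases q.walk.darts.getLast? <;> simp
  omega

/-- **The junction corners** of the link of `w` from `A` to `B`: the corners deciding its first
edge (leaving `A`) and its last edge (entering `B`) — the "at most two faces" recoloured by
Bollobás–Riordan. [cite: BollobasRiordan2010, §5.2] -/
def junctionCorners (A B : Set (Site 2)) (w : XWalk) : Finset (Site 2) :=
  endCorners (minimalLink A B w)

/-- There are at most two junction corners. [folklore] -/
theorem card_junctionCorners_le (A B : Set (Site 2)) (w : XWalk) : (junctionCorners A B w).card ≤ 2 :=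
  card_endCorners_le _

variable (n s m : ℕ)

/-- **The link walk**: the chosen non-slant path of the fresh configuration `ω₂ = cornerConfig S₂`
in `[0, m]²`, translated by `X`. [cite: BollobasRiordan2010, §5.1 proof of Thm. 5.3] -/
def linkWalk (S₂ : Set (Site 2 × Fin 2)) (X : Site 2) : XWalk := (nsPath m (cornerConfig S₂)).shift X

/-- The junction corners of the resampling datum `q = (S₁, S₂, X)`: those of the link walk of
`(S₂, X)` relative to the lower region of `S₁` (square `[0,n]²`) and the upper region of `S₁`
(square `[0,n] × [s, n+s]`). [cite: BollobasRiordan2010, §5.2] -/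
def juncCorners (q : Set (Site 2 × Fin 2) × (Set (Site 2 × Fin 2) × Site 2)) : Finset (Site 2) :=
  junctionCorners (lowerRegion n (cornerConfig q.1)) (upperRegion n s (cornerConfig q.1))
    (linkWalk m q.2.1 q.2.2)

/-- **The modification site**: all coins of the junction corners (at most four coins).
[cite: BollobasRiordan2010, §5.2] -/
def juncSite (q : Set (Site 2 × Fin 2) × (Set (Site 2 × Fin 2) × Site 2)) : Finset (Site 2 × Fin 2) :=
  juncCorners n s m q ×ˢ Finset.univ

/-- **The imposed pattern**: at each junction corner the coin shows `1` and the splitting bit `0`,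
so that BOTH edges of the corner are open (`east_mem_cornerConfig_iff`,
`north_mem_cornerConfig_iff`); its `cornerPercolation t`-probability is `(1/2)(1 - t/2) ≥ 1/4`
per corner. [cite: BollobasRiordan2010, §5.2] -/
def juncPattern (q : Set (Site 2 × Fin 2) × (Set (Site 2 × Fin 2) × Site 2)) : Finset (Site 2 × Fin 2) :=
  juncCorners n s m q ×ˢ {0}

/-- The pattern lies in the site. [folklore] -/
theorem juncPattern_subset_juncSite (q : Set (Site 2 × Fin 2) × (Set (Site 2 × Fin 2) × Site 2)) :
    juncPattern n s m q ⊆ juncSite n s m q :=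
  Finset.product_subset_product_right (Finset.subset_univ _)

/-- The site has at most four coins. [folklore] -/
theorem card_juncSite_le (q : Set (Site 2 × Fin 2) × (Set (Site 2 × Fin 2) × Site 2)) :
    (juncSite n s m q).card ≤ 4 := by
  rw [juncSite, Finset.card_product, Finset.card_univ, Fintype.card_fin]
  have := card_junctionCorners_le (lowerRegion n (cornerConfig q.1)) (upperRegion n s (cornerConfig q.1))
    (linkWalk m q.2.1 q.2.2)
  unfold juncCorners
  omega

/-- **The recolouring map `g`** of Bollobás–Riordan: overwrite the coins of the junction corners
of `ω₁ = q.1` by the pattern opening both of their edges, keep `(S₂, X)`.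
[cite: BollobasRiordan2010, §5.2] -/
def recolour (q : Set (Site 2 × Fin 2) × (Set (Site 2 × Fin 2) × Site 2)) :
    Set (Site 2 × Fin 2) × (Set (Site 2 × Fin 2) × Site 2) :=
  (setOn (juncSite n s m q) ↑(juncPattern n s m q) q.1, q.2)

end Link

/-! ### The stub statements of the reshaped engine (named `Prop`s the line posits) -/

section Statements

open MeasureTheory

/-- The uniform Non-Slant lemma (kernel). -/
def NonSlantStatement : Prop :=
  ∃ c : ℝ, 0 < c ∧ ∃ n₀ : ℕ, ∀ (t : unitInterval) (n : ℕ), n₀ ≤ n →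
    c ≤ (cornerPercolation t).real {ω | ∃ x ∈ bottomSide n n, ∃ y ∈ topSide n n,
      5 * |y 0 - x 0| ≤ 3 * (n : ℤ) ∧ ω ∈ openConnIn (↑(rectangle n n)) x y}

/-- Winding-number bridge: for an interface walk of the lower hull of `[0,n]²` (on `H([0,n]²)`),
the extended walk winds `-1` around every hull face and `0` around every other face of the dual
square. -/
def BridgeStatement : Prop :=
  ∀ (n : ℕ) (ω : BondConfig (Site 2)), ω ⊆ (zdGraph 2).edgeSet →
    (∀ f ∈ dualTopSide n n, f ∉ dualBelow n ω) →
    ∀ (w : XWalk), IsSquareCrossing n w.walk →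
      (∀ d ∈ w.walk.darts, IsBdryEdge (lowerHull n ω) n d.edge) →
      (∀ f ∈ lowerHull n ω, walkWinding (extendRight w.walk 0) f = -1) ∧
      (∀ f ∈ dualRectangle n n, f ∉ lowerHull n ω → walkWinding (extendRight w.walk 0) f = 0)

/-- Coins agreeing on the examined coins of `S` produce the same explored face sets. -/
def ExaminedStatement : Prop :=
  ∀ (n s : ℕ) (S S' : Set (Site 2 × Fin 2)),
    (∀ i ∈ examinedCoins n s S, i ∈ S ↔ i ∈ S') →
    dualBelow n (cornerConfig S') = dualBelow n (cornerConfig S) ∧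
    dualAbove n s (cornerConfig S') = dualAbove n s (cornerConfig S)

/-- Order under `¬ JOIN` (Bollobás–Riordan: "since `J` does not hold, `UH(S₁)` is strictly below
`LH(S₂)`", and "a crossing of `S₁` above a crossing of `S₂` gives `J`"), in region form, for
`S₁ = [0,n]²`, `S₂ = S₁ + (0,s)` crossed horizontally and not joined: (i) COVER — every strip
point lies in the upper region of `S₁` (explored from above, shift parameter `0`) or in the lower
region of `S₂` (the lower region of the configuration translated down by `s`); (ii) DISJOINT —
inside `S₁ ∪ S₂` the lower region of `S₁` does not meet the upper region of `S₂`. -/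
def CoverStatement : Prop :=
  ∀ (n s : ℕ) (ω : BondConfig (Site 2)), ω ⊆ (zdGraph 2).edgeSet → 1 ≤ s → s ≤ n →
    ω ∈ lrCrossing n n → ω ∈ upperLR n s → ω ∉ joinEvent n s →
    (∀ v : Site 2, 0 ≤ v 0 → v 0 ≤ n →
      v ∈ upperRegion n 0 ω ∨
      v - ![0, (s : ℤ)] ∈ lowerRegion n (BondConfig.relabel (sym2Equiv (Site.shift (-![0, (s : ℤ)]))) ω)) ∧
    (∀ v ∈ rectangle n (n + s), v ∈ lowerRegion n ω → v ∉ upperRegion n s ω)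

/-- B–R Lemma 5.6 for `M_t` (probability form, constants of line `Sketch`). -/
def SmallGapStatement : Prop :=
  ∃ c₃ : ℝ, 0 < c₃ ∧ ∀ (t : unitInterval) (k : ℕ), 1 ≤ k →
    c₃ ≤ (cornerPercolation t).real (joinEvent (32000 * k) k) ∨
    c₃ ≤ (cornerPercolation t).real (smallGapEvent (32000 * k) k (360000 * k ^ 2))

/-- Junction invariance: recolouring the junction corners leaves both explorations unchanged. -/
def JunctionStatement : Prop :=
  ∀ (n s m : ℕ) (S₁ S₂ : Set (Site 2 × Fin 2)) (X : Site 2), 1 ≤ s → s ≤ n →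
    (∀ v ∈ rectangle n (n + s), v ∈ lowerRegion n (cornerConfig S₁) → v ∉ upperRegion n s (cornerConfig S₁)) →
    (linkWalk m S₂ X).fst ∈ lowerRegion n (cornerConfig S₁) →
    (linkWalk m S₂ X).snd ∈ upperRegion n s (cornerConfig S₁) →
    dualBelow n (cornerConfig (recolour n s m (S₁, S₂, X)).1) = dualBelow n (cornerConfig S₁) ∧
    dualAbove n s (cornerConfig (recolour n s m (S₁, S₂, X)).1) = dualAbove n s (cornerConfig S₁)

/-- The link: the spliced, recoloured configuration has joined crossings. -/
def LinkStatement : Prop :=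
  BridgeStatement → ExaminedStatement →
  ∀ (n s m : ℕ) (S₁ S₂ : Set (Site 2 × Fin 2)) (X : Site 2), 1 ≤ s → s ≤ n →
    cornerConfig S₁ ∈ lrCrossing n n → cornerConfig S₁ ∈ upperLR n s →
    (∀ v ∈ rectangle n (n + s), v ∈ lowerRegion n (cornerConfig S₁) → v ∉ upperRegion n s (cornerConfig S₁)) →
    cornerConfig S₂ ∈ nonSlant m →
    (linkWalk m S₂ X).fst ∈ lowerRegion n (cornerConfig S₁) →
    (linkWalk m S₂ X).snd ∈ upperRegion n s (cornerConfig S₁) →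
    (∀ z ∈ (linkWalk m S₂ X).walk.support, 0 ≤ z 0 ∧ z 0 ≤ n) →
    dualBelow n (cornerConfig (recolour n s m (S₁, S₂, X)).1) = dualBelow n (cornerConfig S₁) →
    dualAbove n s (cornerConfig (recolour n s m (S₁, S₂, X)).1) = dualAbove n s (cornerConfig S₁) →
    cornerConfig (brSplice n s (recolour n s m (S₁, S₂, X))) ∈ joinEvent n s

/-- The uniform hard-way bound (weakest form of B–R Thm 5.3), the old conclusion of `stub_brTB`. -/
def TBStatement : Prop :=
  ∃ c : ℝ, 0 < c ∧ ∃ K n₀ : ℕ, ∀ (t : unitInterval) (n : ℕ), n₀ ≤ n →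
    ∃ k : ℕ, 1 ≤ k ∧ k ≤ n ∧ n ≤ K * k ∧ c ≤ (cornerPercolation t).real (tbCrossing n (n + k))

end Statements

/-! ### Registered glue -/

/-- Statement form of `juncPattern_subset_juncSite` (the imposed pattern lies in the modification
site): a registered glue step the LINE POSITS and proves right below; not a literature fact,
never to be relocated. -/
def JuncPatternSubsetStatement : Prop :=
  ∀ (n s m : ℕ) (q : Set (Site 2 × Fin 2) × (Set (Site 2 × Fin 2) × Site 2)),
    juncPattern n s m q ⊆ juncSite n s m q

/-- The imposed pattern lies in the modification site. [folklore] -/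
theorem juncPatternSubset_holds : JuncPatternSubsetStatement := fun n s m q => juncPattern_subset_juncSite n s m q

end Summit.CriticalPhenomena.CardyFormulaZ2.Cruxes.UniformBoxCrossing.NonSlantLine
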